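import Summits.HodgeConjecture.HodgeConjecture.Theorems.F0P6aDatumOfInputsDefs
import Summits.HodgeConjecture.HodgeConjecture.Theorems.F0P6aQuotientFibreEngineInputs
import Literature.AlgebraicGeometry.AbelianSchemes.RoofLegsSpecialFibre
import Literature.AlgebraicGeometry.AbelianSchemes.RoofMiddleDualOfIdealTorsionQuotient
import Literature.AlgebraicGeometry.AbelianSchemes.AbelianSchemeConstSubgroupQuotientSmooth
import Literature.AlgebraicGeometry.AbelianSchemes.AbelianSchemeQuotientIsoOfKernelRank
import Literature.NumberTheory.NumberFields.GaloisConjugatePrimeIdealArithmetic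
import HarnessLib
import HarnessLib.Audit.LibrarySuggestionsDenyListCruxes

/-!
# `F0P6aStubFROBRoofMiddleDualTop` — ★ RE-HOME of the crux workfile `Lines/F0_P6a_StubFROBRoofMiddleDual.lean` (tree sha16 7f144f7cb2cd1e30, 431 l., 14 declaration commands, code-`sorry`-free), PART 1 of 2

This `Theorems/` module is the TREE BYTES of that workfile with the NAMESPACE KEPT, so every fully-qualified name is UNCHANGED; only this module docstring is re-headed,
the `Lines` imports are switched to their ★ re-homed twins — `Lines.F0_P6a_DatumOfInputs` → ★ `Theorems.F0P6aDatumOfInputsDefs`; `Lines.F0_P6a_QuotientFibreEngineInputs` → ★ `Theorems.F0P6aQuotientFibreEngineInputs` — and the audit carrier `LibrarySuggestionsDenyListCruxes` is CARRIED on this root part (bare import, LEAD «M-142d» (1) rule «P-κ»; parts 2…n inherit it transitively)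
Why a re-home: a `Theorems/` file cannot import a `Lines/` workfile (F0P6-ref1 o-6), and closing stmt-HodgeConjecture-24832 `--as proved --by <Theorems decl>` at rung 0 needs the
sorry-free `Lines` chain behind the gate (RE-HOME TABLE v1.7, LA7-plan (g7); PLAN «L3 cone RE-HOME» v1, LA3-plan (g5); LEAD F0P6-plan (g5) «M-140» (1)∕(4), 2026-09-02).
SIZE LINT (`Theorems/` files with proofs ≤ 400 l.): the workfile is cut into 2 consecutive parts `F0P6aStubFROBRoofMiddleDualTop` → `F0P6aStubFROBRoofMiddleDual`; this is PART 1 (tree lines :1–:366); each later part imports the previous one and re-opens the scopes open at its cut with their `variable`∕`open`∕`set_option` lines replayed verbatim; the LAST part `F0P6aStubFROBRoofMiddleDual` is the module the `Lines/` shim and consumers import.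
After the chain is ★ the `Lines` workfile becomes a one-import SHIM of `F0P6aStubFROBRoofMiddleDual` (a `Lines/` write, batched per cone on the LEAD՚s word), so no environment holds two copies (NO-CROSS-IMPORT).
It asserts nothing beyond what the workfile already proves.  HC_CM is proved only modulo the 7 printed citations (2 remaining: hLiu418 = stmt-HodgeConjecture-24832, h413 = stmt-HodgeConjecture-24833) until rung 0 closes; a re-home is count-neutral.

## Original module docstring (verbatim)
# F0 · P6a — `stub_FROB` ROOF road, W1-b: THE MIDDLE DUAL OF THE DOWNSTAIRS ROOF, THE KERNEL ROW (K1), AND THE `Roof₀` ASSEMBLY — ALL `q̄`-PARAMETRIC (leaflet ED. 1 cand v1, HOME-first; LA3-p01 (g2))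

`crux_decl: Summit.HodgeConjecture.HodgeConjecture.Theses.HCCMUnconditional.HLiu418`.  Cell `hodgecm-mathlib` (D-0151), «GO 500» half A line L3 (socket `stub_FROB` of the
D-line `Lines/F0_P6a_DatumOfInputs.lean` :554; L3 closer leaf `Lines/F0_P6a_StubFROB.lean`, socket `stub_ROOF0`; dealer LA3-plan (g2) RULING (R2-refined) 2026-09-02T08:52:57Z:
W1-a `Lines/F0_P6a_StubFROBRoofLegs.lean` = the LEGS with the kernel rows, ONE ∃-head `roofLegs_of_roofLink_kerRows` (pen LA1-p04 (g3)); W1-b = THIS leaflet (pen LA3-p01 (g2)),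
rule 27: it does NOT import W1-a — every declaration is over explicit binders, so the two leaflets kick independently and meet only in the W5 junction).  ONE-∃ DOCTRINE: every declaration here is `q̄`-FREE or `q̄`-PARAMETRIC — nothing re-obtains a leg; the W5 junction destructures W1-a's head ONCE and feeds the
components for ITS `q̄`.  CONTENT: §2 (`q̄`-free) **the downstairs dual `(DB̄, λ_B̄)` of the middle `B̄ = 𝒞_{x̄″}`** (`𝒞 = I.univ ⊗ 𝔭_w⁻¹`) with `c̄ ≫ λ_B̄ ≫ c̄^∨ = λ_{x̄″} ≫ [p]`, from
the (ρ-𝔟) chain — ★ (2b) `exists_idealClass_quotient_kernelLaw_dualPair` at `x̄″` (QFEI leaflet §4), ★ (B) square p849397, ★ (S-u) twist hom p849451, ★ NT scalar p849504, ★ transport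
p849288, ★ conjugation-cancel, assembled in ★ `exists_dualPair_comp_lam_comp_dualIsogenyOver_eq_mulN_of_kernelLaws'` (p849680∕p849700) — split in two declarations for the tree's
400 000-heartbeat cap; §5 the `Roof₀` packaging `roof₀_of_rows₀` with the rows (r2₀)(r4₀)(r5₀) taken in the ★ iterated-base-change currency and converted on atoms; §5b the kernel row
**(K1) «`Ker q̄ ⊆ A[p·d]`, `p ∤ d`»** from (r3₀-q) and the spine row `polQuasiInv` (`kernelUpperBound₀`, `kernelUpperBound₀_of_r3`); §6 **`roof₀_of_legRows`**: for ANY homomorphism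
`q̄ : A_x̄ → 𝒞_{x̄″}` with the legs rows (r1₀)(r4₀-q)(r5₀-q)(r3₀-q ∀) (the components of W1-a's head) and the congruence-relation clause (rL) for a co-ideal `𝔠`,
`Roof₀ 𝓜 w I.univ I.act I.dual I.pol I.lvl p f 𝔭_w 𝔠 x̄ x̄″`.  HOME-only candidate: NO `crux write` by an L-seat; box → LEAD word → writer.  HC_CM is proved only modulo the 7 printed
citations (2 remaining named inputs hLiu418 24832, h413 24833) until rung 0 closes; count-neutral.
[cite: Liu2021, Prop. D.8 (3) p. 135, pp. 136–138] [cite: RapoportSmithlingZhang2020Diagonal, §4.1 p. 17; §4.3 (4.23) p. 21] [cite: MumfordAV1970, §7 Thm. 4 p. 72; §15 Thm. 1 p. 143; §23 Thm. 2 p. 231]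
[cite: Conrad2004GrossZagier, §7 Thm. 7.5] [cite: Kottwitz1992, §5, pp. 390–391] [cite: MilneCM2006, §7 (Def. 7.19, Prop. 7.22, Rem. 7.23, pp. 58–59)]
-/


set_option autoImplicit false

noncomputable section

namespace Summit.HodgeConjecture.HodgeConjecture.Cruxes.HLiu418.F0P6aStubFROBRoofMiddleDual

set_option linter.dupNamespace false  -- `Summit.HodgeConjecture.HodgeConjecture.…` BY DESIGN (D-0017)

open CategoryTheory CategoryTheory.Limits NumberField IsDedekindDomain MulAction AlgebraicGeometry
open scoped Matrix Pointwise MonObj nonZeroDivisors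
open Literature.NumberTheory.GaloisRepresentations
open Literature.NumberTheory.Automorphic Literature.NumberTheory.Automorphic.UnitaryGroup
open Literature.AlgebraicGeometry.ShimuraVarieties.UnitaryCanonicalModel
open Literature.NumberTheory.Automorphic.Liu2021.AppendixC
open Literature.AlgebraicGeometry.Motives (AlgPoints IntegralModel SchemeOver thickening thickeningLift specOver relFrobeniusOver frobSpec)
open Literature.NumberTheory.DiophantineGeometry (geomResidueField specialFibreFunctor specResidueField)
open Literature.AlgebraicGeometry.RelativeSpec (ActionOver)
open Literature.NumberTheory.EllipticCurves (genericFibre specGenericPoint)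
open Literature.AlgebraicGeometry.AbelianSchemes Literature.AlgebraicGeometry.AbelianSchemes.AbelianSchemeOver
open Summit.HodgeConjecture.HodgeConjecture.Cruxes.HLiu418.F0P6aModuliDatumDefs
open Summit.HodgeConjecture.HodgeConjecture.Cruxes.HLiu418.F0P6aRGDAssembly
open Summit.HodgeConjecture.HodgeConjecture.Cruxes.HLiu418.F0P6aDatumOfInputs
open Summit.HodgeConjecture.HodgeConjecture.Cruxes.HLiu418.F0P6aQuotientFibreEngineInputs

set_option backward.isDefEq.respectTransparency false

variable {F : Type} [Field F] [NumberField F] [IsCMField F] {ι₁ : F →+* ℂ}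
    {Jstar : Matrix (Fin 2) (Fin 2) F}
    {K₀ : C5.OpenCompactSubgroup ↥(finAdelic ↥(maximalRealSubfield F) F (IsCMField.complexConj F) 2 Jstar)}
    {S : RecordSystemGS F Jstar ι₁ K₀} {hU7ₛ : S.HeckeTranslateDefinedOver}
    {hJ : (Jstar.map (IsCMField.complexConj F))ᵀ = Jstar} {hJu : IsUnit Jstar}
    {Fi : Type} [Field Fi] [Algebra F Fi] {Kc : C5.SmallLevel K₀} {G : Type} [Group G]
    {𝓜 : IntegralModel (𝓞 F) F ((thickening F Fi).obj (S.M.obj Kc))}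
    {w : HeightOneSpectrum (𝓞 F)} {hw : (IsCMField.complexConj F) • w ≠ w} {h𝓨 : (𝓜.localise w).IsSmoothProper 1}
    {θ : ActionOver (𝓜.localise w).total.hom ((Fi ≃ₐ[F] Fi) × G)}
    {e : Fi →ₐ[F] AlgebraicClosure (w.adicCompletion F)}

/-! ### §1 The Rosati pair `(a, ā)` for `𝔭_w` from `I.rosati` and `𝔭_w ⊔ 𝔭_{w̄} = ⊤` -/

omit [IsCMField F] in
/-- `𝔭_w` and `𝔭_{c•w}` are COPRIME when `c • w ≠ w` (distinct maximal ideals of the Dedekind domain `𝓞 F`). [cite: Kottwitz1992, §5 (p. 390)] -/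
theorem asIdeal_sup_smul_asIdeal_eq_top {c : F ≃ₐ[↥(maximalRealSubfield F)] F} (hcw : c • w ≠ w) :
    w.asIdeal ⊔ (c • w).asIdeal = ⊤ :=
  Ideal.IsMaximal.coprime_of_ne w.isMaximal (c • w).isMaximal fun h => hcw (HeightOneSpectrum.ext h.symm)

-- (K6 ★ twin — gate `dedup.landed`, dealer LA3-plan (g5)): the tree's LOCAL copy of `exists_asIdeal_mul_map_conj_mul_eq_span` (17 l. incl. docstring)
-- is DELETED here; the landed ★ `Literature.NumberTheory.NumberFields.exists_asIdeal_mul_map_conj_mul_eq_span`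
-- (`GaloisConjugatePrimeIdealArithmetic.lean`) is cited by FQN at its use site(s) in this file.  Every other byte = tree ED. of record.

-- (K6 ★ twin — gate `dedup.landed`, dealer LA3-plan (g5)): the tree's LOCAL copy of `conjRingEquiv_apply_apply` (6 l. incl. docstring)
-- is DELETED here; the landed ★ `Literature.NumberTheory.NumberFields.conjRingEquiv_apply_apply`
-- (`GaloisConjugatePrimeIdealArithmetic.lean`) is cited by FQN at its use site(s) in this file.  Every other byte = tree ED. of record.


/-! ### §2 THE MIDDLE: the downstairs dual `(DB̄, λ_B̄)` of `B̄ = 𝒞_x̄` with `c̄ ≫ λ_B̄ ≫ c̄^∨ = λ_x̄ ≫ [p]` — road (ρ-𝔟), ALL ★ -/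

set_option maxHeartbeats 400000 in
/-- (M1, inner) **THE DUAL OF THE ROOF MIDDLE FROM AN ABSTRACT `𝔟`-QUOTIENT AT `x̄`**: for a homomorphism `q_K : A_x̄ → Q` (flat, surjective, quasi-compact) whose kernel on all
`T`-points is the `𝔟`-torsion, `𝔟 = x·𝔭_w` (`x ≠ 0`), and a dual pair `DQ` of `Q` with its unit pin — the shape of QFEI §4's output, `Q` ABSTRACT (so that the finite-quotient
term `A_x̄ ∕ A_x̄[𝔟]` never enters a unification here; split for the tree's 400 000-heartbeat cap, measured) — the ★ (ρ-𝔟) assembly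
`exists_dualPair_comp_lam_comp_dualIsogenyOver_eq_mulN_of_kernelLaws'` at the D-line carriers: `c̄`'s kernel law (★ `comp_coverLeg_eq_one_iff_forall_mem`), the Rosati rows
(QFEI `rosati_sch₀Of`, ALL `b`), W1-a §1 `𝔭_w·c(𝔭_w) ∣ (p)` and `c (c y) = y`. [cite: MumfordAV1970, §23 Thm. 2 (p. 231), §15 Thm. 1 (p. 143)] [cite: MilneCM2006, §7 (pp. 58–59)] -/
theorem exists_roofMiddleDual₀_of_quotient (I : RGDInputsAt F ι₁ Jstar K₀ S hU7ₛ hJ hJu Fi Kc G 𝓜 w hw h𝓨 θ e)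
    {m : ℕ} (E' : Matrix (Fin m) (Fin m) (𝓞 F)) (hE' : E' * E' = E') (P : Matrix (Fin m) (Fin 1) (𝓞 F)) (Q : Matrix (Fin 1) (Fin m) (𝓞 F))
    (hP : E' * P = P) (hQ : Q * E' = Q) (hQP : Q * P = Matrix.scalar (Fin 1) (I.pChar : 𝓞 F))
    (hPQ : P * Q = Matrix.scalar (Fin m) (I.pChar : 𝓞 F) * E') (h𝔭 : Ideal.span (Set.range fun k => P k 0) = w.asIdeal)
    (xbar : AlgPoints (𝓜.localise w).reductionAt (geomResidueField w))
    -- an abstract `𝔟`-quotient `q_K : A_x̄ → Q` with a dual pair (QFEI §4's output shape)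
    {Qx : AbelianSchemeOver (Spec (CommRingCat.of (geomResidueField w)))} (qK : (sch₀Of 𝓜 w I.univ xbar).X ⟶ Qx.X) [IsMonHom qK]
    (hflat : Flat qK.left) (hsurj : Surjective qK.left) (hqc : QuasiCompact qK.left)
    (DQ : Qx.DualPair) (hunit : Nonempty ((Scheme.Modules.pullback (DualPair.unitHatSlice DQ)).obj DQ.P ≅ SheafOfModules.unit _))
    {x : F} {𝔟 : Ideal (𝓞 F)} (hx0 : x ≠ 0) (h𝔟0 : 𝔟 ≠ ⊥)
    (hcls : (𝔟 : FractionalIdeal (𝓞 F)⁰ F) = FractionalIdeal.spanSingleton (𝓞 F)⁰ x * (w.asIdeal : FractionalIdeal (𝓞 F)⁰ F))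
    (hker : ∀ ⦃T : SchemeOver (geomResidueField w)⦄ (t : T ⟶ (sch₀Of 𝓜 w I.univ xbar).X), t ≫ qK = 1 ↔ ∀ b ∈ 𝔟, t ≫ ((I.act.baseChange (pullback.fst (𝓜.localise w).total.hom (specResidueField w))).baseChange xbar.left).i b = 1) :
    haveI := I.comm
    ∃ (DBs : (((serreTensor I.act E' hE').baseChange (pullback.fst (𝓜.localise w).total.hom (specResidueField w))).baseChange xbar.left).DualPair)
      (_ : Nonempty ((Scheme.Modules.pullback (DualPair.unitHatSlice DBs)).obj DBs.P ≅ SheafOfModules.unit _))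
      (lamBs : (((serreTensor I.act E' hE').baseChange (pullback.fst (𝓜.localise w).total.hom (specResidueField w))).baseChange xbar.left).X ⟶ DBs.hat.X) (_ : IsMonHom lamBs),
      haveI := isMonHom_coverLeg (pullback.fst (𝓜.localise w).total.hom (specResidueField w)) xbar.left I.act E' hE' P
      baseChangeHom (baseChangeHom (serreTranslate I.act E' hE' P) (pullback.fst (𝓜.localise w).total.hom (specResidueField w))) xbar.left ≫ lamBs ≫
          DualPair.dualIsogenyOver (baseChangeHom (baseChangeHom (serreTranslate I.act E' hE' P) (pullback.fst (𝓜.localise w).total.hom (specResidueField w))) xbar.left)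
            ((I.dual.baseChange (pullback.fst (𝓜.localise w).total.hom (specResidueField w))).baseChange xbar.left) DBs =
        ((I.pol.baseChange (pullback.fst (𝓜.localise w).total.hom (specResidueField w))).baseChange xbar.left).lam ≫ ((I.dual.baseChange (pullback.fst (𝓜.localise w).total.hom (specResidueField w))).baseChange xbar.left).hat.mulN I.pChar := by
  haveI := I.comm
  have hN : I.pChar ≠ 0 := I.hpChar.1.ne_zero
  haveI := isCommMonObj_sch₀Of 𝓜 w I.univ xbar
  -- the cover leg at `x̄`
  haveI := isMonHom_coverLeg (pullback.fst (𝓜.localise w).total.hom (specResidueField w)) xbar.left I.act E' hE' P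
  haveI := surjective_coverLeg_left (pullback.fst (𝓜.localise w).total.hom (specResidueField w)) xbar.left I.act E' hE' P Q hN hP hQ hQP hPQ
  haveI := isMonHom_pol₀Of_lam 𝓜 w I.univ xbar I.pol
  -- `𝔭_w · c(𝔭_w) · 𝔡 = (p)` (W1-a §1)
  refine (Literature.NumberTheory.NumberFields.exists_asIdeal_mul_map_conj_mul_eq_span (w := w) hw I.hpChar.2).elim fun 𝔡 hpd => ?_
  -- the ★ assembly, applied WITHOUT expected type (pure inference), then ONE unification with the goal
  have key := exists_dualPair_comp_lam_comp_dualIsogenyOver_eq_mulN_of_kernelLaws'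
    ((I.act.baseChange (pullback.fst (𝓜.localise w).total.hom (specResidueField w))).baseChange xbar.left) (MulSemiringAction.toRingEquiv _ (𝓞 F) (IsCMField.complexConj F))
    (dual₀Of 𝓜 w I.univ I.dual xbar) (pol₀Of 𝓜 w I.univ I.pol xbar).nonempty_unitHatSlice_iso (pol₀Of 𝓜 w I.univ I.pol xbar).lam qK DQ hunit
    (baseChangeHom (baseChangeHom (serreTranslate I.act E' hE' P) (pullback.fst (𝓜.localise w).total.hom (specResidueField w))) xbar.left)
    (Literature.NumberTheory.NumberFields.conjRingEquiv_apply_apply (F := F)) (fun b => rosati_sch₀Of I xbar b _ rfl) h𝔟0 w.ne_bot hker hflat hsurj hqc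
    (fun T t => comp_coverLeg_eq_one_iff_forall_mem (pullback.fst (𝓜.localise w).total.hom (specResidueField w)) xbar.left I.act E' hE' P hP h𝔭 t) hx0 hcls 𝔡 hpd
  exact key

set_option maxHeartbeats 400000 in
/-- **THE DUAL OF THE ROOF MIDDLE AT A SPECIAL POINT `x̄`** (road (ρ-𝔟), LA3-plan (g0) RULINGS #5–#7): for `I : RGDInputsAt …`, a Serre presentation `(E′, P, Q)` of `𝔭_w`
with scalar `p = I.pChar`, and ANY special point `x̄ ∈ 𝓨_s(κ̄(w))`: a dual pair `DB̄` of the Serre fibre `𝒞_x̄ = ((I.univ ⊗ 𝔭_w⁻¹) ×_𝓨 𝓨_s)_x̄` WITH its unit pin and a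
homomorphism `λ_B̄ : 𝒞_x̄ → B̄^` with **`c̄ ≫ λ_B̄ ≫ c̄^∨ = λ_x̄ ≫ [p]`** for the cover leg `c̄ = (ψ_P ×_𝓨 𝓨_s)_x̄`.  ★ (2b) at `x̄` (pack §4: `q_K`, `DQ`, unit pin, kernel law
`A_x̄[𝔟]`, `↑𝔟 = x·↑𝔭_w`; `M := p`), `c̄`'s kernel law (★ `comp_coverLeg_eq_one_iff_forall_mem`), the Rosati rows (pack `rosati_sch₀Of`, ALL `b`), §1 `𝔭_w·c(𝔭_w) ∣ (p)`, then
★ `exists_dualPair_comp_lam_comp_dualIsogenyOver_eq_mulN_of_kernelLaws'`. [cite: MumfordAV1970, §23 Thm. 2 (p. 231), §15 Thm. 1 (p. 143)] [cite: MilneCM2006, §7 (pp. 58–59)] -/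
theorem exists_roofMiddleDual₀ (I : RGDInputsAt F ι₁ Jstar K₀ S hU7ₛ hJ hJu Fi Kc G 𝓜 w hw h𝓨 θ e)
    {m : ℕ} (E' : Matrix (Fin m) (Fin m) (𝓞 F)) (hE' : E' * E' = E') (P : Matrix (Fin m) (Fin 1) (𝓞 F)) (Q : Matrix (Fin 1) (Fin m) (𝓞 F))
    (hP : E' * P = P) (hQ : Q * E' = Q) (hQP : Q * P = Matrix.scalar (Fin 1) (I.pChar : 𝓞 F))
    (hPQ : P * Q = Matrix.scalar (Fin m) (I.pChar : 𝓞 F) * E') (h𝔭 : Ideal.span (Set.range fun k => P k 0) = w.asIdeal)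
    (xbar : AlgPoints (𝓜.localise w).reductionAt (geomResidueField w)) :
    haveI := I.comm
    ∃ (DBs : (((serreTensor I.act E' hE').baseChange (pullback.fst (𝓜.localise w).total.hom (specResidueField w))).baseChange xbar.left).DualPair)
      (_ : Nonempty ((Scheme.Modules.pullback (DualPair.unitHatSlice DBs)).obj DBs.P ≅ SheafOfModules.unit _))
      (lamBs : (((serreTensor I.act E' hE').baseChange (pullback.fst (𝓜.localise w).total.hom (specResidueField w))).baseChange xbar.left).X ⟶ DBs.hat.X) (_ : IsMonHom lamBs),
      haveI := isMonHom_coverLeg (pullback.fst (𝓜.localise w).total.hom (specResidueField w)) xbar.left I.act E' hE' P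
      baseChangeHom (baseChangeHom (serreTranslate I.act E' hE' P) (pullback.fst (𝓜.localise w).total.hom (specResidueField w))) xbar.left ≫ lamBs ≫
          DualPair.dualIsogenyOver (baseChangeHom (baseChangeHom (serreTranslate I.act E' hE' P) (pullback.fst (𝓜.localise w).total.hom (specResidueField w))) xbar.left)
            ((I.dual.baseChange (pullback.fst (𝓜.localise w).total.hom (specResidueField w))).baseChange xbar.left) DBs =
        ((I.pol.baseChange (pullback.fst (𝓜.localise w).total.hom (specResidueField w))).baseChange xbar.left).lam ≫ ((I.dual.baseChange (pullback.fst (𝓜.localise w).total.hom (specResidueField w))).baseChange xbar.left).hat.mulN I.pChar := by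
  haveI := I.comm
  have hN : I.pChar ≠ 0 := I.hpChar.1.ne_zero
  haveI := isCommMonObj_sch₀Of 𝓜 w I.univ xbar
  haveI := isSeparated_sch₀Of 𝓜 w I.univ xbar
  haveI := locallyOfFiniteType_sch₀Of 𝓜 w I.univ xbar
  -- (2b) at `x̄` with `𝔞 := 𝔭_w`, `M := p` (QFEI §4) — destructured by `Exists.elim` + projections, NOT `obtain` (each `cases` step re-checks the motive = this goal,
  -- ≈ 7·10⁴ heartbeats a component at these carriers — measured)
  refine (exists_idealClass_quotient_kernelLaw_dualPair_sch₀Of I xbar w.asIdeal w.ne_bot hN (dvd_refl I.pChar)).elim fun x h => h.elim fun 𝔟 h => h.elim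
    fun n h => h.elim fun K h => h.elim fun hfin h => h.elim fun DQ h => ?_
  have hker := h.2.2.2.2.2.2.2.2.2.1
  haveI := hfin
  -- strip the `show … from` wrapper (`have this := q_K; this`) off the kernel law, so that the unifications below with the ★ quotient lemmas
  -- (`flat_quotientMk_left`, …, stated for the bare `quotientMk`) are syntactic
  dsimp only at hker
  -- `q_K` is a homomorphism (★ `isMonHom_quotientMk`, typed at the carrier `(quotientBy …).X` of `DQ`); flat, surjective, quasi-compact by ★ name
  haveI : @IsMonHom _ _ _ (sch₀Of 𝓜 w I.univ xbar).X ((sch₀Of 𝓜 w I.univ xbar).quotientBy (𝟙 (Spec (.of (geomResidueField w)))) K ((sch₀Of 𝓜 w I.univ xbar).hcov_of_field K) ((sch₀Of 𝓜 w I.univ xbar).exists_grpObj_isMonHom_quotientMk_of_field K ((sch₀Of 𝓜 w I.univ xbar).hcov_of_field K)) ((sch₀Of 𝓜 w I.univ xbar).smooth_quotientOver_hom_of_field K ((sch₀Of 𝓜 w I.univ xbar).hcov_of_field K)) ((sch₀Of 𝓜 w I.univ xbar).geometricallyConnected_quotientOver_hom (𝟙 (Spec (.of (geomResidueField w)))) K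 ((sch₀Of 𝓜 w I.univ xbar).hcov_of_field K))).X _ _ ((sch₀Of 𝓜 w I.univ xbar).quotientMk (𝟙 (Spec (.of (geomResidueField w)))) K ((sch₀Of 𝓜 w I.univ xbar).hcov_of_field K)) :=
    (sch₀Of 𝓜 w I.univ xbar).isMonHom_quotientMk (𝟙 _) K ((sch₀Of 𝓜 w I.univ xbar).hcov_of_field K) ((sch₀Of 𝓜 w I.univ xbar).exists_grpObj_isMonHom_quotientMk_of_field K ((sch₀Of 𝓜 w I.univ xbar).hcov_of_field K))
      ((sch₀Of 𝓜 w I.univ xbar).smooth_quotientOver_hom_of_field K ((sch₀Of 𝓜 w I.univ xbar).hcov_of_field K)) ((sch₀Of 𝓜 w I.univ xbar).geometricallyConnected_quotientOver_hom (𝟙 _) K ((sch₀Of 𝓜 w I.univ xbar).hcov_of_field K))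
  exact exists_roofMiddleDual₀_of_quotient I E' hE' P Q hP hQ hQP hPQ h𝔭 xbar _
    ((sch₀Of 𝓜 w I.univ xbar).flat_quotientMk_left (𝟙 _) K ((sch₀Of 𝓜 w I.univ xbar).hcov_of_field K) ((sch₀Of 𝓜 w I.univ xbar).translation_free_of_field K))
    ((sch₀Of 𝓜 w I.univ xbar).surjective_quotientMk_left (𝟙 _) K ((sch₀Of 𝓜 w I.univ xbar).hcov_of_field K))
    (haveI := (sch₀Of 𝓜 w I.univ xbar).isAffineHom_quotientMk_left (𝟙 _) K ((sch₀Of 𝓜 w I.univ xbar).hcov_of_field K); (inferInstance : QuasiCompact ((sch₀Of 𝓜 w I.univ xbar).quotientMk (𝟙 (Spec (.of (geomResidueField w)))) K ((sch₀Of 𝓜 w I.univ xbar).hcov_of_field K)).left))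
    DQ h.2.2.2.2.2.2.2.2.2.2 h.1 h.2.1 h.2.2.1 hker


set_option maxHeartbeats 400000 in
/-- (M1, W5 form) `exists_roofMiddleDual₀` in the TOKEN FORM of the W5a junction's `HoleMiddle` (LA3-p02 (g3) v3 3e944a46 :460 — carriers spelled `sch₀Of`∕`dual₀Of`∕`pol₀Of`,
universally over `x̄`): the abbreviations are unfolded HERE once (reducible, measured), so that W5b discharges `HoleMiddle` by ONE syntactic application. -/
theorem exists_roofMiddleDual₀' (I : RGDInputsAt F ι₁ Jstar K₀ S hU7ₛ hJ hJu Fi Kc G 𝓜 w hw h𝓨 θ e)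
    {m : ℕ} (E' : Matrix (Fin m) (Fin m) (𝓞 F)) (hE' : E' * E' = E') (P : Matrix (Fin m) (Fin 1) (𝓞 F)) (Q : Matrix (Fin 1) (Fin m) (𝓞 F))
    (hP : E' * P = P) (hQ : Q * E' = Q) (hQP : Q * P = Matrix.scalar (Fin 1) (I.pChar : 𝓞 F))
    (hPQ : P * Q = Matrix.scalar (Fin m) (I.pChar : 𝓞 F) * E') (h𝔭 : Ideal.span (Set.range fun k => P k 0) = w.asIdeal) :
    haveI := I.comm
    ∀ (xbar : AlgPoints (𝓜.localise w).reductionAt (geomResidueField w)),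
      ∃ (DBs : (sch₀Of 𝓜 w (serreTensor I.act E' hE') xbar).DualPair)
        (_ : Nonempty ((Scheme.Modules.pullback (DualPair.unitHatSlice DBs)).obj DBs.P ≅ SheafOfModules.unit _))
        (lamBs : (sch₀Of 𝓜 w (serreTensor I.act E' hE') xbar).X ⟶ DBs.hat.X) (_ : IsMonHom lamBs),
        haveI := isMonHom_coverLeg (pullback.fst (𝓜.localise w).total.hom (specResidueField w)) xbar.left I.act E' hE' P
        baseChangeHom (baseChangeHom (serreTranslate I.act E' hE' P) (pullback.fst (𝓜.localise w).total.hom (specResidueField w))) xbar.left ≫ lamBs ≫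
            DualPair.dualIsogenyOver (baseChangeHom (baseChangeHom (serreTranslate I.act E' hE' P) (pullback.fst (𝓜.localise w).total.hom (specResidueField w))) xbar.left)
              (dual₀Of 𝓜 w I.univ I.dual xbar) DBs =
          (pol₀Of 𝓜 w I.univ I.pol xbar).lam ≫ (dual₀Of 𝓜 w I.univ I.dual xbar).hat.mulN I.pChar :=
  fun xbar => exists_roofMiddleDual₀ I E' hE' P Q hP hQ hQP hPQ h𝔭 xbar

/-! ### §5 Dictionary (`rfl`-lemmas) between the D-line carriers and the iterated-base-change currency, and the `Roof₀` packaging -/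

section Dictionary

variable {X : SchemeOver F} (𝓜₀ : IntegralModel (𝓞 F) F X) (w₀ : HeightOneSpectrum (𝓞 F))
  (𝒜 : AbelianSchemeOver (𝓜₀.localise w₀).total.left) (ρ : AbelianSchemeOver.RingAction (𝓞 F) 𝒜)
  (xbar : AlgPoints (𝓜₀.localise w₀).reductionAt (geomResidueField w₀))

omit [IsCMField F] in
/-- `act₀Of … a x̄` on the underlying group schemes IS the iterated base change of `ι(a)` (★ `fibreHom_hom_hom_hom`; P6d probe `rfl`). [cite: Kottwitz1992, §5 (p. 390)] -/
theorem act₀Of_hom_hom_hom (a : 𝓞 F) :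
    (act₀Of 𝓜₀ w₀ 𝒜 ρ a xbar).hom.hom.hom =
      ((ρ.baseChange (pullback.fst (𝓜₀.localise w₀).total.hom (specResidueField w₀))).baseChange xbar.left).i a := rfl

omit [IsCMField F] in
/-- `lvlPt₀Of … lvl x̄ a` IS the point of the pulled-back section `lvl(a) ×_𝓨 𝓨_s` at `x̄` (★ `LevelStructure.baseChange_section_`).
[cite: MumfordFogartyKirwan1994, Ch. 7 §2 Definition 7.1 (p. 129)] -/
theorem lvlPt₀Of_eq {g₀ n : ℕ} (lvl : 𝒜.LevelStructure g₀ n) (a : Fin g₀ ⊕ Fin g₀ → ZMod n) :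
    lvlPt₀Of 𝓜₀ w₀ 𝒜 lvl xbar a =
      (𝒜.baseChange (pullback.fst (𝓜₀.localise w₀).total.hom (specResidueField w₀))).restrictPt xbar.left
        (𝒜.sectionBaseChange (pullback.fst (𝓜₀.localise w₀).total.hom (specResidueField w₀)) (lvl.section_ a)) := by
  rw [lvlPt₀Of, LevelStructure.baseChange_section_]

end Dictionary

/-! ### §5 (cont.) The `Roof₀` packaging, rows in the ★ currency (`act₀Of_hom_hom_hom` ∕ `lvlPt₀Of_eq` applied HERE on atoms) -/

section Packaging

variable {X : SchemeOver F} (𝓜₀ : IntegralModel (𝓞 F) F X) (w₀ : HeightOneSpectrum (𝓞 F))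
  (𝒜 : AbelianSchemeOver (𝓜₀.localise w₀).total.left) (ρ : AbelianSchemeOver.RingAction (𝓞 F) 𝒜)
  (D : 𝒜.DualPair) (pol : 𝒜.Polarization D) {g₀ n : ℕ} (lvl : 𝒜.LevelStructure g₀ n)
  (pChar fDeg : ℕ) [ExpChar (geomResidueField w₀) pChar] (𝔭 𝔠 : Ideal (𝓞 F))
  (xbar xbar'' : AlgPoints (𝓜₀.localise w₀).reductionAt (geomResidueField w₀))

omit [IsCMField F] in
set_option maxHeartbeats 400000 in
/-- **`Roof₀` FROM ITS ROWS, THE ROWS IN THE ★ CURRENCY** (the ∃-packaging of Defs ED. 3 :542 together with the three dictionary conversions, done HERE on atoms `𝒜 ρ lvl x̄ x̄″ B`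
where they are cheap — at the D-line carriers each `act₀Of_hom_hom_hom`∕`lvlPt₀Of_eq` motive costs ≈ 1–2·10⁵ heartbeats, measured): middle `B̄`, dual pair `DB` with the J12 unit pin, `λ_B̄`, legs
`q̄`, `c̄`, a common-endomorphism family `sact`, and the rows (r1₀) (r3₀-q) (r3₀-c) (rL) verbatim, (r2₀) (r4₀) (r5₀) in the iterated-base-change currency of ★ p847713 ∕ ★ #3-bis
(`((ρ.baseChange ι_s).baseChange x̄.left).i a`, `restrictPt … (sectionBaseChange …)`) ⟹ `Roof₀ …`. [cite: Liu2021, Prop. D.8 (3) p. 135, pp. 136–138] -/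
theorem roof₀_of_rows₀ (B : AbelianSchemeOver (Spec (CommRingCat.of (geomResidueField w₀)))) (DB : B.DualPair) (lamB : B.X ⟶ DB.hat.X) [IsMonHom lamB]
    (hDB : Nonempty ((Scheme.Modules.pullback DB.unitHatSlice).obj DB.P ≅ SheafOfModules.unit _))
    (q : (sch₀Of 𝓜₀ w₀ 𝒜 xbar).X ⟶ B.X) [IsMonHom q] (c : (sch₀Of 𝓜₀ w₀ 𝒜 xbar'').X ⟶ B.X) [IsMonHom c] (sact : 𝓞 F → (B.X ⟶ B.X))
    (h1 : Flat q.left ∧ Function.Surjective q.left.base)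
    (h2 : ∀ ⦃T : SchemeOver (geomResidueField w₀)⦄ (t : T ⟶ (sch₀Of 𝓜₀ w₀ 𝒜 xbar'').X),
      t ≫ c = 1 ↔ ∀ a ∈ 𝔭, t ≫ ((ρ.baseChange (pullback.fst (𝓜₀.localise w₀).total.hom (specResidueField w₀))).baseChange xbar''.left).i a = 1)
    (h2s : Function.Surjective c.left.base)
    (h3q : q ≫ lamB ≫ DualPair.dualIsogenyOver q (dual₀Of 𝓜₀ w₀ 𝒜 D xbar) DB = (pol₀Of 𝓜₀ w₀ 𝒜 pol xbar).lam ≫ (dual₀Of 𝓜₀ w₀ 𝒜 D xbar).hat.mulN pChar)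
    (h3c : c ≫ lamB ≫ DualPair.dualIsogenyOver c (dual₀Of 𝓜₀ w₀ 𝒜 D xbar'') DB =
      (pol₀Of 𝓜₀ w₀ 𝒜 pol xbar'').lam ≫ (dual₀Of 𝓜₀ w₀ 𝒜 D xbar'').hat.mulN pChar)
    (h4q : ∀ a : 𝓞 F, ((ρ.baseChange (pullback.fst (𝓜₀.localise w₀).total.hom (specResidueField w₀))).baseChange xbar.left).i a ≫ q = q ≫ sact a)
    (h4c : ∀ a : 𝓞 F, ((ρ.baseChange (pullback.fst (𝓜₀.localise w₀).total.hom (specResidueField w₀))).baseChange xbar''.left).i a ≫ c = c ≫ sact a)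
    (h5 : ∀ a : Fin g₀ ⊕ Fin g₀ → ZMod n,
      AlgPoints.map q ((𝒜.baseChange (pullback.fst (𝓜₀.localise w₀).total.hom (specResidueField w₀))).restrictPt xbar.left (𝒜.sectionBaseChange (pullback.fst (𝓜₀.localise w₀).total.hom (specResidueField w₀)) (lvl.section_ a))) =
        AlgPoints.map c ((𝒜.baseChange (pullback.fst (𝓜₀.localise w₀).total.hom (specResidueField w₀))).restrictPt xbar''.left (𝒜.sectionBaseChange (pullback.fst (𝓜₀.localise w₀).total.hom (specResidueField w₀)) (lvl.section_ a))))
    (hL : ∀ ⦃T : SchemeOver (geomResidueField w₀)⦄ (t : T ⟶ (sch₀Of 𝓜₀ w₀ 𝒜 xbar).X),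
      t ≫ relFrobeniusOver pChar fDeg (sch₀Of 𝓜₀ w₀ 𝒜 xbar).X =
          (1 : T ⟶ ((sch₀Of 𝓜₀ w₀ 𝒜 xbar).baseChange (frobSpec (geomResidueField w₀) pChar fDeg)).X) ↔
        ∀ a ∈ 𝔠, t ≫ (act₀Of 𝓜₀ w₀ 𝒜 ρ a xbar).hom.hom.hom ≫ q = 1) :
    Roof₀ 𝓜₀ w₀ 𝒜 ρ D pol lvl pChar fDeg 𝔭 𝔠 xbar xbar'' := by
  refine ⟨B, DB, lamB, ‹IsMonHom lamB›, hDB, q, ‹IsMonHom q›, c, ‹IsMonHom c›, h1.1, h1.2, fun T t => ?_, h2s, h3q, h3c, fun a => ⟨sact a, ?_, ?_⟩,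
    fun a => ?_, hL⟩
  · simp only [act₀Of_hom_hom_hom]; exact h2 t
  · rw [act₀Of_hom_hom_hom]; exact h4q a
  · rw [act₀Of_hom_hom_hom]; exact h4c a
  · rw [lvlPt₀Of_eq, lvlPt₀Of_eq]; exact h5 a

end Packaging

/-! ### §5b (K1, ruling (K-ROWS)) THE KERNEL OF THE LEG IS KILLED BY `[p·d]`, `p ∤ d` — from (r3₀)-q and the spine row `polQuasiInv` -/

/-- (K1-generic) **A ROOF LEG'S KERNEL IS KILLED BY `[p·d]`**: if `q ≫ λ_B ≫ q^∨ = λ ≫ [p]` ((r3₀)-q) and `λ ≫ ν = [d]` with `ν` a homomorphism (the spine row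
`polQuasiInv`), then every `T`-point `z` with `z ≫ q = 1` has `z ≫ [p·d] = 1`: `z ≫ [d] ≫ [p] = z ≫ λ ≫ ν ≫ [p] = (z ≫ λ ≫ [p]) ≫ ν = (z ≫ q) ≫ (λ_B ≫ q^∨) ≫ ν = 1`
(homomorphisms commute with `[p]` and kill `1`).  Pure category algebra over any base. -/
theorem comp_mulN_mul_eq_one_of_comp_eq_one {B₀ : Scheme.{0}} {A B : AbelianSchemeOver B₀} (q : A.X ⟶ B.X) [IsMonHom q]
    (DA : A.DualPair) (DB : B.DualPair) (lam : A.X ⟶ DA.hat.X) (lamB : B.X ⟶ DB.hat.X) [IsMonHom lamB] [IsMonHom (DualPair.dualIsogenyOver q DA DB)]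
    {p d : ℕ} (h3 : q ≫ lamB ≫ DualPair.dualIsogenyOver q DA DB = lam ≫ DA.hat.mulN p) (ν : DA.hat.X ⟶ A.X) [IsMonHom ν] (hν : lam ≫ ν = A.mulN d)
    ⦃T : Over B₀⦄ (z : T ⟶ A.X) (hz : z ≫ q = 1) : z ≫ A.mulN (p * d) = 1 := by
  have h1 : z ≫ lam ≫ DA.hat.mulN p = 1 := by
    rw [← h3, ← Category.assoc, hz]; exact MonObj.one_comp _
  calc z ≫ A.mulN (p * d) = z ≫ (lam ≫ ν) ≫ A.mulN p := by rw [hν, mulN_comp_mulN, Nat.mul_comm]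
    _ = (z ≫ lam ≫ DA.hat.mulN p) ≫ ν := by simp only [Category.assoc, comp_mulN_eq_mulN_comp ν p]
    _ = 1 := by rw [h1]; exact MonObj.one_comp _

/-- (K1-generic, TWICE BASE-CHANGED) the same with the quasi-inverse `λ ≫ ν = [d]` given UPSTAIRS on `A ∕ S` and the roof leg on the iterated base change
`(A ×_S S′) ×_{S′} S″` (★ `baseChangeHom_comp_eq_pow_id_of_comp_eq_pow_id` twice, ★ `Polarization.baseChange_lam`, ★ `isMonHom_baseChangeHom`) — stated with `A, D, λ, g, g′`
VARIABLES so that the definitional bookkeeping `((D ×_S S′) ×_{S′} S″)^ = (D̂ ×_S S′) ×_{S′} S″` is unfolded on atoms (at the D-line carriers the same unfolding costs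
≈ 5·10⁵ heartbeats — measured). -/
theorem comp_mulN_mul_eq_one_of_comp_eq_one_baseChange₂ {B₀ B₁ B₂ : Scheme.{0}} (g : B₁ ⟶ B₀) (g' : B₂ ⟶ B₁) {A : AbelianSchemeOver B₀}
    (DA : A.DualPair) (pol : A.Polarization DA) {d : ℕ} (ν : DA.hat.X ⟶ A.X) [IsMonHom ν] (hν : pol.lam ≫ ν = A.mulN d)
    {B : AbelianSchemeOver B₂} (q : ((A.baseChange g).baseChange g').X ⟶ B.X) [IsMonHom q] (DB : B.DualPair) (lamB : B.X ⟶ DB.hat.X) [IsMonHom lamB]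
    [IsMonHom (DualPair.dualIsogenyOver q ((DA.baseChange g).baseChange g') DB)] {p : ℕ}
    (h3 : q ≫ lamB ≫ DualPair.dualIsogenyOver q ((DA.baseChange g).baseChange g') DB =
      ((pol.baseChange g).baseChange g').lam ≫ ((DA.baseChange g).baseChange g').hat.mulN p)
    ⦃T : Over B₂⦄ (z : T ⟶ ((A.baseChange g).baseChange g').X) (hz : z ≫ q = 1) : z ≫ ((A.baseChange g).baseChange g').mulN (p * d) = 1 := by
  haveI := isMonHom_baseChangeHom ν g
  haveI := isMonHom_baseChangeHom (baseChangeHom ν g) g'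
  refine comp_mulN_mul_eq_one_of_comp_eq_one q _ DB _ lamB h3 (baseChangeHom (baseChangeHom ν g) g') ?_ z hz
  rw [Polarization.baseChange_lam, Polarization.baseChange_lam, mulN_def]
  exact baseChangeHom_comp_eq_pow_id_of_comp_eq_pow_id g' _ _ (baseChangeHom_comp_eq_pow_id_of_comp_eq_pow_id g pol.lam ν (by rw [hν, mulN_def]))

set_option maxHeartbeats 400000 in
/-- (K1) **`Ker q̄ ⊆ A_x̄[p·d]` with `p ∤ d`** at a geometric point `x̄` of the special fibre, for ANY homomorphism `q̄ : A_x̄ → B` carrying a polarisation law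
`q̄ ≫ λ_B ≫ q̄^∨ = λ_x̄ ≫ [p]` ((r3₀)-q) towards a dual pair `DB` with the unit pin: the spine row `I.polQuasiInv : λ ≫ ν = [d]`, `p ∤ d`, base-changed to `x̄`
and the roof law fed to `comp_mulN_mul_eq_one_of_comp_eq_one_baseChange₂` (atoms upstairs, ONE syntactic application here); `q̄^∨` is a homomorphism over the reduced base `Spec κ̄`
(★ `isMonHom_dualIsogenyOver`), and `ι(p·d) = [p·d]` (★ `RingAction.i_natCast`).  The (K1) row of the ROOF0 closer's kernel bookkeeping (ruling (K-ROWS)). -/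
theorem kernelUpperBound₀ (I : RGDInputsAt F ι₁ Jstar K₀ S hU7ₛ hJ hJu Fi Kc G 𝓜 w hw h𝓨 θ e) (xbar : AlgPoints (𝓜.localise w).reductionAt (geomResidueField w))
    {B : AbelianSchemeOver (Spec (CommRingCat.of (geomResidueField w)))} (q : (sch₀Of 𝓜 w I.univ xbar).X ⟶ B.X) [IsMonHom q]
    (DBs : B.DualPair) (hDBs : Nonempty ((Scheme.Modules.pullback (DualPair.unitHatSlice DBs)).obj DBs.P ≅ SheafOfModules.unit _))
    (lamBs : B.X ⟶ DBs.hat.X) [IsMonHom lamBs]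
    (hq3 : haveI := I.comm
      q ≫ lamBs ≫ DualPair.dualIsogenyOver q ((I.dual.baseChange (pullback.fst (𝓜.localise w).total.hom (specResidueField w))).baseChange xbar.left) DBs =
        ((I.pol.baseChange (pullback.fst (𝓜.localise w).total.hom (specResidueField w))).baseChange xbar.left).lam ≫
          ((I.dual.baseChange (pullback.fst (𝓜.localise w).total.hom (specResidueField w))).baseChange xbar.left).hat.mulN I.pChar) :
    ∃ d : ℕ, I.pChar.Coprime d ∧ ∀ ⦃T : SchemeOver (geomResidueField w)⦄ (z : T ⟶ (sch₀Of 𝓜 w I.univ xbar).X), z ≫ q = 1 →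
      z ≫ (act₀Of 𝓜 w I.univ I.act ((I.pChar * d : ℕ) : 𝓞 F) xbar).hom.hom.hom = 1 := by
  haveI := I.comm
  refine I.polQuasiInv.elim fun d h => h.elim fun ν h => ?_
  haveI := h.1
  haveI := DualPair.isMonHom_dualIsogenyOver q ((I.dual.baseChange (pullback.fst (𝓜.localise w).total.hom (specResidueField w))).baseChange xbar.left) DBs
    hDBs (pol₀Of 𝓜 w I.univ I.pol xbar).nonempty_unitHatSlice_iso
  refine ⟨d, h.2.1, fun T z hz => ?_⟩
  rw [act₀Of_hom_hom_hom, RingAction.i_natCast, ← mulN_def]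
  exact comp_mulN_mul_eq_one_of_comp_eq_one_baseChange₂ (pullback.fst (𝓜.localise w).total.hom (specResidueField w)) xbar.left I.dual I.pol ν h.2.2
    q DBs lamBs hq3 z hz

set_option maxHeartbeats 400000 in
/-- (K1, from the (r3₀-q) ROW) **`Ker q̄ ⊆ A_x̄[p·d]`, `p ∤ d`** for any homomorphism `q̄ : A_x̄ → 𝒞_(x̄″)` carrying the polarisation law (r3₀-q) FOR EVERY downstairs `(DB̄, λ_B̄)` with
`c̄^*λ_B̄ = λ_(x̄″) ≫ [p]` (the row of W1-a's head, `c̄` the cover leg): §2 supplies one such `(DB̄, λ_B̄)`, then `kernelUpperBound₀`.  `q̄`-PARAMETRIC (ONE-∃ doctrine). -/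
theorem kernelUpperBound₀_of_r3 (I : RGDInputsAt F ι₁ Jstar K₀ S hU7ₛ hJ hJu Fi Kc G 𝓜 w hw h𝓨 θ e)
    {m : ℕ} (E' : Matrix (Fin m) (Fin m) (𝓞 F)) (hE' : E' * E' = E') (P : Matrix (Fin m) (Fin 1) (𝓞 F)) (Q : Matrix (Fin 1) (Fin m) (𝓞 F))
    (hP : E' * P = P) (hQ : Q * E' = Q) (hQP : Q * P = Matrix.scalar (Fin 1) (I.pChar : 𝓞 F))
    (hPQ : P * Q = Matrix.scalar (Fin m) (I.pChar : 𝓞 F) * E') (h𝔭 : Ideal.span (Set.range fun k => P k 0) = w.asIdeal)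
    (xbar xbar'' : AlgPoints (𝓜.localise w).reductionAt (geomResidueField w))
    (q : (sch₀Of 𝓜 w I.univ xbar).X ⟶ (haveI := I.comm; (sch₀Of 𝓜 w (serreTensor I.act E' hE') xbar'').X)) [IsMonHom q]
    (h3q : haveI := I.comm
      ∀ (DBs : (((serreTensor I.act E' hE').baseChange (pullback.fst (𝓜.localise w).total.hom (specResidueField w))).baseChange xbar''.left).DualPair)
        (_ : Nonempty ((Scheme.Modules.pullback (DualPair.unitHatSlice DBs)).obj DBs.P ≅ SheafOfModules.unit _))
        (lamBs : (((serreTensor I.act E' hE').baseChange (pullback.fst (𝓜.localise w).total.hom (specResidueField w))).baseChange xbar''.left).X ⟶ DBs.hat.X) [IsMonHom lamBs],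
        (haveI := isMonHom_coverLeg (pullback.fst (𝓜.localise w).total.hom (specResidueField w)) xbar''.left I.act E' hE' P
         baseChangeHom (baseChangeHom (serreTranslate I.act E' hE' P) (pullback.fst (𝓜.localise w).total.hom (specResidueField w))) xbar''.left ≫ lamBs ≫
            DualPair.dualIsogenyOver (baseChangeHom (baseChangeHom (serreTranslate I.act E' hE' P) (pullback.fst (𝓜.localise w).total.hom (specResidueField w))) xbar''.left)
              ((I.dual.baseChange (pullback.fst (𝓜.localise w).total.hom (specResidueField w))).baseChange xbar''.left) DBs =
          ((I.pol.baseChange (pullback.fst (𝓜.localise w).total.hom (specResidueField w))).baseChange xbar''.left).lam ≫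
            ((I.dual.baseChange (pullback.fst (𝓜.localise w).total.hom (specResidueField w))).baseChange xbar''.left).hat.mulN I.pChar) →
        q ≫ lamBs ≫ DualPair.dualIsogenyOver q ((I.dual.baseChange (pullback.fst (𝓜.localise w).total.hom (specResidueField w))).baseChange xbar.left) DBs =
          ((I.pol.baseChange (pullback.fst (𝓜.localise w).total.hom (specResidueField w))).baseChange xbar.left).lam ≫
            ((I.dual.baseChange (pullback.fst (𝓜.localise w).total.hom (specResidueField w))).baseChange xbar.left).hat.mulN I.pChar) :
    ∃ d : ℕ, I.pChar.Coprime d ∧ ∀ ⦃T : SchemeOver (geomResidueField w)⦄ (z : T ⟶ (sch₀Of 𝓜 w I.univ xbar).X), z ≫ q = 1 →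
      z ≫ (act₀Of 𝓜 w I.univ I.act ((I.pChar * d : ℕ) : 𝓞 F) xbar).hom.hom.hom = 1 := by
  haveI := I.comm
  refine (exists_roofMiddleDual₀ I E' hE' P Q hP hQ hQP hPQ h𝔭 xbar'').elim fun DBs h => h.elim fun hDBs h => h.elim fun lamBs h => h.elim fun hlamBs hc3 => ?_
  haveI := hlamBs
  exact kernelUpperBound₀ I xbar q DBs hDBs lamBs (h3q DBs hDBs lamBs hc3)


/-! (★ re-home, size lint: PART 1 of 2 ends here at tree line :366; the workfile continues, in the same namespace, in `Theorems/F0P6aStubFROBRoofMiddleDual.lean`.) -/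

end Summit.HodgeConjecture.HodgeConjecture.Cruxes.HLiu418.F0P6aStubFROBRoofMiddleDual
end
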